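/-
line stmt-HodgeConjecture-18881 Cruxes/BlochSeedDiscOne/Lines/birth.lean 814a6a70c14e831a stub_rung_pad4_seedAt

U-EFLAT (hsemireg-alphabet-unipotent-1 · g18) — kernel shadow of THEOREM Q♭ / THEOREM (E♭)
(memo `U-EFLAT-unipotent1-g18.md`).  Mathlib only; no `instance`, no notation, no banned option.

PEN THEOREM (memo §2–§3).  R = k⟦z,w⟧, N a finite-length R-module ↔ a commuting nilpotent pair
(A,B) on V = kⁿ;  μ = dim N/𝔪N,  t = dim soc N = dim (ker A ∩ ker B),  e = dim End_R N = dim Z(A,B).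
  THEOREM Q♭ : dim 𝒫(m,t;n) ≤ n² − C(m+1,2) − C(t,2)   (𝒫(m,t;n) = pairs with μ = m, type t),
  THEOREM (E♭): 2e ≥ μ(μ+1) + t(t−1)  and  2e ≥ t(t+1) + μ(μ−1), i.e.
                e ≥ C(max(μ,t)+1,2) + C(min(μ,t),2),  for EVERY finite-length N (sharp for every (μ,t)).
Consequences: (E_soc) e ≥ C(t+1,2), (E_gen) e ≥ C(μ+1,2) — the two hypotheses `2E ≥ t(t+1)`,
`2E ≥ m(m+1)` of g17's kernel `F_pos` (UnipotentESocLaw.lean) — hence THEOREM E_all and THEOREM U-PROD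
tier (ii) are unconditional.

WHAT THIS FILE KERNEL-CHECKS: the TYPED STATEMENTS `EFlat`, `ESocEGen` (Props over `Matrix`/`LinearMap`/
`Subalgebra.centralizer`; stated, not proved) and the typed reduction `ESocEGen_of_EFlat`; the arithmetic heart of the induction step (L6) (`qflat_step_identity`,
`consec_mul_nonneg`, `qflat_step`); the induction scheme itself over an ABSTRACT dimension function on
strata (`qflat_bound`: any D satisfying the base case and the Grassmann-fibration recursion (L1)+(L5) obeys
the Q♭ bound); the linear-algebra lemma (L3) dim K + dim(𝔪I) = 2 dim I (`finrank_ker_coprod_neg`);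
the corollary chain orbit ⊂ stratum ⇒ (E♭) ⇒ max/min form ⇒ the `F_pos` hypotheses; domination of
Ellingsrud–Lehn's Lemma 7; the sharpness identity; digit checks.
WHAT IT DOES NOT CHECK (pen, memo §2): that the strata / Grassmann fibres are varieties of the stated
dimensions (orbit lemma, fibre-dimension theorem, determinantal rank loci, base change).
Census-neutral: nothing here is proved toward HC / HC_CM / HC_AV / №4 / 26512 / 18881 / H2.
-/
import Mathlib

namespace HsemiregUnipotentG18

/-! ## §0  The typed statement of THEOREM (E♭) (stated, NOT proved in this file — pen proof in the memo)

A finite-length module over `k⟦z,w⟧` of length `n` is a commuting nilpotent pair `(A,B)` on `Fin n → K`;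
`μ` = corank of `[A | B]` (generators), `t` = dim `ker A ⊓ ker B` (socle), `e` = dim of the centralizer
subalgebra of `{A, B}` in `M_n(K)` (= `End_R N`). -/

/-- THEOREM (E♭), typed over Mathlib objects: for every commuting nilpotent pair,
`max(μ,t)(max(μ,t)+1) + min(μ,t)(min(μ,t)−1) ≤ 2e`.  (Pen theorem of the memo; recorded here as a `Prop`
so that a later seat can target it literally.  Nothing in this file proves it.) -/
def EFlat (K : Type) [Field K] (n : ℕ) : Prop :=
  ∀ A B : Matrix (Fin n) (Fin n) K, A * B = B * A → IsNilpotent A → IsNilpotent B →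
    max (Module.finrank K ((Fin n → K) ⧸
            (LinearMap.range (Matrix.toLin' A) ⊔ LinearMap.range (Matrix.toLin' B))))
        (Module.finrank K (LinearMap.ker (Matrix.toLin' A) ⊓ LinearMap.ker (Matrix.toLin' B)
            : Submodule K (Fin n → K)))
      * (max (Module.finrank K ((Fin n → K) ⧸
            (LinearMap.range (Matrix.toLin' A) ⊔ LinearMap.range (Matrix.toLin' B))))
        (Module.finrank K (LinearMap.ker (Matrix.toLin' A) ⊓ LinearMap.ker (Matrix.toLin' B)
            : Submodule K (Fin n → K))) + 1)
    + min (Module.finrank K ((Fin n → K) ⧸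
            (LinearMap.range (Matrix.toLin' A) ⊔ LinearMap.range (Matrix.toLin' B))))
        (Module.finrank K (LinearMap.ker (Matrix.toLin' A) ⊓ LinearMap.ker (Matrix.toLin' B)
            : Submodule K (Fin n → K)))
      * (min (Module.finrank K ((Fin n → K) ⧸
            (LinearMap.range (Matrix.toLin' A) ⊔ LinearMap.range (Matrix.toLin' B))))
        (Module.finrank K (LinearMap.ker (Matrix.toLin' A) ⊓ LinearMap.ker (Matrix.toLin' B)
            : Submodule K (Fin n → K))) - 1)
    ≤ 2 * Module.finrank K (Subalgebra.centralizer K ({A, B} : Set (Matrix (Fin n) (Fin n) K)))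

/-- The weaker g17 conjectures as typed statements: (E_soc) `t(t+1) ≤ 2e` and (E_gen) `μ(μ+1) ≤ 2e`. -/
def ESocEGen (K : Type) [Field K] (n : ℕ) : Prop :=
  ∀ A B : Matrix (Fin n) (Fin n) K, A * B = B * A → IsNilpotent A → IsNilpotent B →
    (Module.finrank K (LinearMap.ker (Matrix.toLin' A) ⊓ LinearMap.ker (Matrix.toLin' B)
        : Submodule K (Fin n → K)))
      * (Module.finrank K (LinearMap.ker (Matrix.toLin' A) ⊓ LinearMap.ker (Matrix.toLin' B)
        : Submodule K (Fin n → K)) + 1)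
      ≤ 2 * Module.finrank K (Subalgebra.centralizer K ({A, B} : Set (Matrix (Fin n) (Fin n) K)))
    ∧ (Module.finrank K ((Fin n → K) ⧸
        (LinearMap.range (Matrix.toLin' A) ⊔ LinearMap.range (Matrix.toLin' B))))
      * (Module.finrank K ((Fin n → K) ⧸
        (LinearMap.range (Matrix.toLin' A) ⊔ LinearMap.range (Matrix.toLin' B))) + 1)
      ≤ 2 * Module.finrank K (Subalgebra.centralizer K ({A, B} : Set (Matrix (Fin n) (Fin n) K)))

/-- The typed reduction (E♭) ⇒ (E_soc) ∧ (E_gen), uniformly in the pair (pure arithmetic on naturals: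
`M(M+1) + m(m−1) ≤ 2e` with `{M,m} = {μ,t}` gives both `t(t+1) ≤ 2e` and `μ(μ+1) ≤ 2e`). -/
theorem ESocEGen_of_EFlat (K : Type) [Field K] (n : ℕ) (h : EFlat K n) : ESocEGen K n := by
  intro A B hAB hA hB
  have h0 := h A B hAB hA hB
  -- abstract the three dimensions
  generalize (Module.finrank K ((Fin n → K) ⧸
      (LinearMap.range (Matrix.toLin' A) ⊔ LinearMap.range (Matrix.toLin' B)))) = μ at h0 ⊢
  generalize (Module.finrank K (LinearMap.ker (Matrix.toLin' A) ⊓ LinearMap.ker (Matrix.toLin' B)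
      : Submodule K (Fin n → K))) = t at h0 ⊢
  generalize (Module.finrank K
      (Subalgebra.centralizer K ({A, B} : Set (Matrix (Fin n) (Fin n) K)))) = e at h0 ⊢
  rcases le_total μ t with hle | hle
  · rw [max_eq_right hle, min_eq_left hle] at h0
    constructor
    · exact le_trans (Nat.le_add_right _ _) h0
    · have : μ * (μ + 1) ≤ t * (t + 1) := Nat.mul_le_mul hle (Nat.add_le_add_right hle 1)
      exact le_trans (le_trans this (Nat.le_add_right _ _)) h0
  · rw [max_eq_left hle, min_eq_right hle] at h0
    constructor
    · have : t * (t + 1) ≤ μ * (μ + 1) := Nat.mul_le_mul hle (Nat.add_le_add_right hle 1)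
      exact le_trans (le_trans this (Nat.le_add_right _ _)) h0
    · exact le_trans (Nat.le_add_right _ _) h0

/-! ## §1  Arithmetic heart of THEOREM Q♭ (memo §2, step L6) -/

/-- A product of two consecutive integers is non-negative. -/
theorem consec_mul_nonneg (x : ℤ) : 0 ≤ x * (x - 1) := by
  rcases le_or_gt x 0 with h | h
  · nlinarith
  · nlinarith

/-- (L6) The one-step identity, all quantities doubled:
`m(n−m) + [(n−m)² − C(m₁+1,2) − C(t₁,2)] + m(n−m−t₁) + (m−j)(m₁+t₁+j)
   = n² − C(m+1,2) − C(t₁+j,2) − (m−m₁−j)(m−m₁−j−1)/2`. -/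
theorem qflat_step_identity (n m m₁ t₁ j : ℤ) :
    2 * (m * (n - m)) + (2 * (n - m) ^ 2 - m₁ * (m₁ + 1) - t₁ * (t₁ - 1))
      + 2 * (m * (n - m - t₁)) + 2 * ((m - j) * (m₁ + t₁ + j))
    = (2 * n ^ 2 - m * (m + 1) - (t₁ + j) * (t₁ + j - 1))
      - (m - m₁ - j) * (m - m₁ - j - 1) := by
  ring

/-- (L6) The induction step: the bound for the sub-stratum `(m₁,t₁; n−m)` of `𝔪N` plus the
Grassmannian `m(n−m)` plus the fibre count `m(n−m−t₁) + (m−j)(m₁+t₁+j)` is at most the bound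
for `(m, t = t₁+j; n)`. -/
theorem qflat_step (n m t m₁ t₁ j Dsub : ℤ) (ht : t = t₁ + j)
    (hIH : 2 * Dsub ≤ 2 * (n - m) ^ 2 - m₁ * (m₁ + 1) - t₁ * (t₁ - 1)) :
    2 * (m * (n - m) + Dsub + m * (n - m - t₁) + (m - j) * (m₁ + t₁ + j))
      ≤ 2 * n ^ 2 - m * (m + 1) - t * (t - 1) := by
  have h1 := qflat_step_identity n m m₁ t₁ j
  have h2 := consec_mul_nonneg (m - m₁ - j)
  subst ht
  nlinarith [h1, h2, hIH]

/-! ## §2  THEOREM Q♭ as an abstract induction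

`P m t n` reads "the stratum 𝒫(m,t;n) is nonempty" and `D m t n : ℤ` is its dimension.  The two
hypotheses are exactly what the geometry supplies (memo §2): (h0) for n = 0 the only nonempty stratum is
(0,0;0), a point; (hrec) for n ≥ 1 a nonempty stratum has 1 ≤ m ≤ n and, by the Grassmann fibration (L1)
and the fibre count (L2)–(L5), its dimension is at most `m(n−m) + D(m₁,t₁;n−m) + m(n−m−t₁) +
(m−j)(m₁+t₁+j)` for SOME nonempty sub-stratum `(m₁,t₁;n−m)` (that of `𝔪N` at a point realising the
maximum) with `t = t₁ + j`, `t₁ ≤ n−m`, `j ≤ m`.  Conclusion: `2·D(m,t;n) ≤ 2n² − m(m+1) − t(t−1)`. -/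
theorem qflat_bound (P : ℕ → ℕ → ℕ → Prop) (D : ℕ → ℕ → ℕ → ℤ)
    (h0 : ∀ m t, P m t 0 → m = 0 ∧ t = 0 ∧ D m t 0 ≤ 0)
    (hrec : ∀ n m t, 1 ≤ n → P m t n →
      1 ≤ m ∧ m ≤ n ∧ ∃ m₁ t₁ j, P m₁ t₁ (n - m) ∧ t = t₁ + j ∧ t₁ ≤ n - m ∧ j ≤ m ∧
        D m t n ≤ (m : ℤ) * ((n : ℤ) - m) + D m₁ t₁ (n - m) + (m : ℤ) * ((n : ℤ) - m - t₁)
                  + ((m : ℤ) - j) * ((m₁ : ℤ) + t₁ + j)) :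
    ∀ n m t, P m t n →
      2 * D m t n ≤ 2 * (n : ℤ) ^ 2 - (m : ℤ) * ((m : ℤ) + 1) - (t : ℤ) * ((t : ℤ) - 1) := by
  intro n
  refine Nat.strong_induction_on n (fun n ih => ?_)
  intro m t hP
  rcases Nat.eq_zero_or_pos n with hn | hn
  · subst hn
    obtain ⟨hm, ht, hD⟩ := h0 m t hP
    subst hm
    subst ht
    push_cast
    linarith
  · obtain ⟨_hm1, hmn, m₁, t₁, j, hP', ht, _ht₁, _hj, hD⟩ := hrec n m t hn hP
    have hlt : n - m < n := by omega
    have ih' := ih (n - m) hlt m₁ t₁ hP'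
    have hcast : ((n - m : ℕ) : ℤ) = (n : ℤ) - (m : ℤ) := by
      rw [Nat.cast_sub hmn]
    rw [hcast] at ih'
    have htz : (t : ℤ) = (t₁ : ℤ) + (j : ℤ) := by exact_mod_cast ht
    have key := qflat_step (n : ℤ) m t m₁ t₁ j (D m₁ t₁ (n - m)) htz ih'
    linarith [key, hD]

/-- The coarser g17-era form THEOREM Q (number of generators only): dropping the socle term. -/
theorem qflat_bound_generators_only (n m t D : ℤ) (ht : 1 ≤ t ∨ t ≤ 0)
    (h : 2 * D ≤ 2 * n ^ 2 - m * (m + 1) - t * (t - 1)) :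
    2 * D ≤ 2 * n ^ 2 - m * (m + 1) := by
  have := consec_mul_nonneg t
  rcases ht with h1 | h1 <;> nlinarith

/-! ## §3  The linear-algebra lemma (L3): dim K + dim (A I + B I) = 2 dim I

For commuting operators `f = A_I`, `g = B_I` on `I`, the space `K = {(x,y) : g x = f y}` is the kernel of
`(x,y) ↦ g x − f y = (g.coprod (−f)) (x,y)`, whose range is `range g ⊔ range f = 𝔪I`. -/

theorem mem_ker_coprod_neg_iff {K V : Type*} [Field K] [AddCommGroup V] [Module K V]
    (f g : V →ₗ[K] V) (x y : V) :
    (x, y) ∈ LinearMap.ker (g.coprod (-f)) ↔ g x = f y := by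
  simp [LinearMap.coprod_apply, add_neg_eq_zero]

theorem finrank_ker_coprod_neg {K V : Type*} [Field K] [AddCommGroup V] [Module K V]
    [FiniteDimensional K V] (f g : V →ₗ[K] V) :
    Module.finrank K (LinearMap.ker (g.coprod (-f)))
      + Module.finrank K (LinearMap.range g ⊔ LinearMap.range f : Submodule K V)
      = 2 * Module.finrank K V := by
  have h1 := LinearMap.finrank_range_add_finrank_ker (g.coprod (-f))
  rw [LinearMap.range_coprod, LinearMap.range_neg, Module.finrank_prod] at h1
  omega

/-- (L3) in the memo's letters: if `dim I = n − m` and `𝔪I = A I + B I` has codimension `m₁` in `I`,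
then `dim K = (n − m) + m₁`. -/
theorem dimK_formula (nm m₁ dimK dimMI : ℤ) (hK : dimK + dimMI = 2 * nm) (hMI : dimMI = nm - m₁) :
    dimK = nm + m₁ := by
  linarith

/-- (L4)–(L5) bookkeeping: `dim Δ = dim I − t₁`, `dim K̄ = dim K − dim Δ = m₁ + t₁`, and the fibre count
`dim Hom(C,Δ) + (rank locus) = m(n−m−t₁) + (m−j)(m + (m₁+t₁) − (m−j))`. -/
theorem fibre_count (n m m₁ t₁ j : ℤ) :
    m * (n - m - t₁) + (m - j) * (m + (m₁ + t₁) - (m - j))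
      = m * (n - m - t₁) + (m - j) * (m₁ + t₁ + j) := by
  ring

/-! ## §4  The corollary chain: orbit ⊂ stratum ⇒ (E♭) ⇒ (E_soc) ∧ (E_gen) ⇒ hypotheses of `F_pos` -/

/-- LEMMA O + THEOREM Q♭: the orbit of `N` (dimension `n² − e`) lies in `𝒫(μ,t;n)` (dimension `D`),
hence form A of (E♭): `μ(μ+1) + t(t−1) ≤ 2e`. -/
theorem eflat_formA_of_orbit (n e μ t D : ℤ) (horbit : n ^ 2 - e ≤ D)
    (hQ : 2 * D ≤ 2 * n ^ 2 - μ * (μ + 1) - t * (t - 1)) :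
    μ * (μ + 1) + t * (t - 1) ≤ 2 * e := by
  linarith

/-- Form B is form A for the Matlis dual / transpose `(Aᵀ,Bᵀ)`: `e` is unchanged and `(μ,t)` swap. -/
theorem eflat_formB_of_dual (e μ t : ℤ) (hA_dual : t * (t + 1) + μ * (μ - 1) ≤ 2 * e) :
    t * (t + 1) + μ * (μ - 1) ≤ 2 * e := hA_dual

/-- (E♭) in the max/min form from the two forms. -/
theorem eflat_max_form (e μ t : ℤ) (hA : μ * (μ + 1) + t * (t - 1) ≤ 2 * e)
    (hB : t * (t + 1) + μ * (μ - 1) ≤ 2 * e) :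
    max μ t * (max μ t + 1) + min μ t * (min μ t - 1) ≤ 2 * e := by
  rcases le_total μ t with h | h
  · rw [max_eq_right h, min_eq_left h]
    linarith
  · rw [max_eq_left h, min_eq_right h]
    linarith

/-- The max/min form is the better of the two: it implies both forms back (for integers). -/
theorem eflat_forms_of_max_form (e μ t : ℤ)
    (h : max μ t * (max μ t + 1) + min μ t * (min μ t - 1) ≤ 2 * e) :
    μ * (μ + 1) + t * (t - 1) ≤ 2 * e ∧ t * (t + 1) + μ * (μ - 1) ≤ 2 * e := by
  rcases le_total μ t with hle | hle
  · rw [max_eq_right hle, min_eq_left hle] at h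
    constructor <;> nlinarith
  · rw [max_eq_left hle, min_eq_right hle] at h
    constructor <;> nlinarith

/-- (E♭) ⇒ (E_soc) `t(t+1) ≤ 2E` and (E_gen) `μ(μ+1) ≤ 2E`: exactly the two hypotheses
`2E ≥ t(t+1)`, `2E ≥ m(m+1)` of g17's kernel `F_pos` (integer version). -/
theorem Fpos_hyps_of_eflat (E μ t : ℤ) (hA : μ * (μ + 1) + t * (t - 1) ≤ 2 * E)
    (hB : t * (t + 1) + μ * (μ - 1) ≤ 2 * E) :
    t * (t + 1) ≤ 2 * E ∧ μ * (μ + 1) ≤ 2 * E := by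
  have h1 := consec_mul_nonneg t
  have h2 := consec_mul_nonneg μ
  constructor <;> linarith

/-- Natural-number version of the same discharge. -/
theorem Fpos_hyps_of_eflat_nat (E μ t : ℕ) (hA : μ * (μ + 1) + t * (t - 1) ≤ 2 * E)
    (hB : t * (t + 1) + μ * (μ - 1) ≤ 2 * E) :
    t * (t + 1) ≤ 2 * E ∧ μ * (μ + 1) ≤ 2 * E :=
  ⟨le_trans (Nat.le_add_right _ _) hB, le_trans (Nat.le_add_right _ _) hA⟩

/-- What Ellingsrud–Lehn's Lemma 7 alone would give via LEMMA O (`e ≥ C(μ,2) + 2t − 1`) does NOT reach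
(E_soc) when `t ≥ 2μ`: a witness of the gap in the g17-open regime (μ,t) = (1,3): E–L gives e ≥ 5,
(E_soc) needs 6 (and (E♭) gives 6). -/
theorem EL_alone_insufficient :
    (1 * (1 - 1) / 2 + 2 * 3 - 1 : ℤ) = 5 ∧ (3 * (3 + 1) / 2 : ℤ) = 6
      ∧ (max 1 3 * (max 1 3 + 1) / 2 + min 1 3 * (min 1 3 - 1) / 2 : ℤ) = 6 := by
  norm_num

/-! ## §5  Domination of Ellingsrud–Lehn, Lemma 7 (memo §3.4)

E–L: `dim Q^{r,e}_{ℓ,i} ≤ (rℓ − 1) − (2(i−1) + C(e,2))`;  Q♭: `≤ rℓ − C(max(e,i)+1,2) − C(min(e,i),2)`.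
Doubled: `2(2i − 1) + e(e−1) ≤ M(M+1) + m(m−1)` — in fact for all integers `e, i` (the difference is
`(i−1)(i−2) + 2(e−i)⁺`). -/
theorem eflat_dominates_EL (e i : ℤ) :
    2 * (2 * i - 1) + e * (e - 1) ≤ max e i * (max e i + 1) + min e i * (min e i - 1) := by
  have hc := consec_mul_nonneg (i - 1)
  rcases le_total e i with h | h
  · rw [max_eq_right h, min_eq_left h]
    nlinarith [hc]
  · rw [max_eq_left h, min_eq_right h]
    nlinarith [hc, h]

/-- Equality cases of the domination: (e,i) ∈ {(1,1),(1,2),(2,2)}. -/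
theorem eflat_EL_equal_cases :
    (2 * (2 * 1 - 1) + 1 * (1 - 1) : ℤ) = max 1 1 * (max 1 1 + 1) + min 1 1 * (min 1 1 - 1)
    ∧ (2 * (2 * 2 - 1) + 1 * (1 - 1) : ℤ) = max 1 2 * (max 1 2 + 1) + min 1 2 * (min 1 2 - 1)
    ∧ (2 * (2 * 2 - 1) + 2 * (2 - 1) : ℤ) = max 2 2 * (max 2 2 + 1) + min 2 2 * (min 2 2 - 1) := by
  norm_num

/-! ## §6  Sharpness of (E♭) (memo §3.3)

For `t ≥ μ` put `p = μ − 1`, `a = t − μ + 1`, `N = k^p ⊕ R/𝔪^a`: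
`e(N) = p² + p(a+1) + C(a+1,2)` and `2e(N) = t(t+1) + μ(μ−1)` identically. -/
theorem sharp_family_identity (p a : ℤ) :
    2 * p ^ 2 + 2 * p * (a + 1) + a * (a + 1) = (a + p) * (a + p + 1) + (p + 1) * (p + 1 - 1) := by
  ring

/-- The g17 sample value: (μ,t) = (2,5), N = k ⊕ R/𝔪⁴: e = 1 + 5 + 10 = 16 = C(6,2) + C(2,2). -/
theorem sharp_digit_2_5 : (1 + 1 * (4 + 1) + 4 * (4 + 1) / 2 : ℤ) = 16 ∧ (6 * 5 / 2 + 2 * 1 / 2 : ℤ) = 16 := by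
  norm_num

/-! ## §7  Digits of the tight strata and of the exhaustive runs (memo §5) -/

/-- Q♭ exponents `n² − C(max+1,2) − C(min,2)` at the strata checked over F_q:
n=3: (1,1)→8, (1,2)→6, (2,2)→5, (3,3)→0;  n=4: (1,1)→15, (1,2)→13, (2,2)→12, (2,3)→9, (3,3)→7, (4,4)→0. -/
theorem qflat_exponent_digits :
    (9 - 1 - 0 : ℤ) = 8 ∧ (9 - 3 - 0 : ℤ) = 6 ∧ (9 - 3 - 1 : ℤ) = 5 ∧ (9 - 6 - 3 : ℤ) = 0
    ∧ (16 - 1 - 0 : ℤ) = 15 ∧ (16 - 3 - 0 : ℤ) = 13 ∧ (16 - 3 - 1 : ℤ) = 12 ∧ (16 - 6 - 1 : ℤ) = 9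
    ∧ (16 - 6 - 3 : ℤ) = 7 ∧ (16 - 10 - 6 : ℤ) = 0 := by
  norm_num

/-- Tight instances of Q♭: the orbit of `(R/𝔪^L)^∨` (μ = L, t = 1, n = C(L+1,2), e = n) has dimension
`n² − n = n² − C(L+1,2) − C(1,2)`; at L = 3: n = 6, 36 − 6 = 36 − 6 − 0. And (2,2;4): 16 − 3 − 1 = 12 =
10 (orbit, e = 6) + 2 (moduli of R/(ℓ₁,𝔪²) ⊕ R/(ℓ₂,𝔪²)); (3,3;4): 16 − 6 − 3 = 7 = 6 + 1. -/
theorem qflat_tight_digits :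
    (36 - 6 : ℤ) = 36 - 3 * 4 / 2 - 1 * 0 / 2 ∧ (16 - 6 + 2 : ℤ) = 16 - 3 - 1
    ∧ (16 - 10 + 1 : ℤ) = 16 - 6 - 3 := by
  norm_num

end HsemiregUnipotentG18
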